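import Mathlib

/-!
# Principal congruence subgroups of `GL_n` over a commutative ring

Tier-5 kernel support (blind cell pub-hodge-repro2, seat p8, gen 11). First step towards the
finiteness of the double-coset spaces `KgK/K` for `K = GL_n(𝒪_v)` (the hypothesis `hfin` of
`T5CartanTransposeGelfand.heckeAlgebra_mul_comm`): the *principal congruence subgroup* of level
`I` is the kernel of reduction modulo `I`,

`K(I) := ker (GL_n(A) → GL_n(A ⧸ I))`,

and it has finite index as soon as `A ⧸ I` is finite (Mathlib's `Subgroup.finiteIndex_ker`:
`GL_n` of a finite ring is finite). For the record's `𝒪_v` with finite residue field every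
non-zero ideal has finite quotient; that fact enters the later files as a hypothesis.

* `mem_ker_map_mk_iff` — `x ∈ K(I) ↔ x ≡ 1 (mod I)` entrywise;
* `mem_ker_map_mk_span_iff` — for `I = (c)`: `x ∈ K(c) ↔ c ∣ x i j − δ i j` for all `i, j`;
* `exists_eq_one_add_smul_of_mem_ker` — `x ∈ K(c) ⇒ x = 1 + c • B` for an integral matrix `B`;
* `finiteIndex_ker_map_mk` — **`K(I)` has finite index in `GL_n(A)` when `A ⧸ I` is finite**.

Hypotheses as stated in the kernel: `A` a commutative ring, `I` an ideal, `ι` a finite type with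
decidable equality; `[Finite (A ⧸ I)]` for the index statement.
-/

namespace Summit.Ventures.HodgeRepro2.T5CongruenceKernel

open Matrix

variable {A : Type*} [CommRing A] {ι : Type*} [Fintype ι] [DecidableEq ι]

/-- Membership in the principal congruence subgroup of level `I`: the matrix is `≡ 1 (mod I)`
entry by entry. -/
theorem mem_ker_map_mk_iff (I : Ideal A) (x : GL ι A) :
    x ∈ (Matrix.GeneralLinearGroup.map (Ideal.Quotient.mk I)).ker ↔
      ∀ i j, (x : Matrix ι ι A) i j - (1 : Matrix ι ι A) i j ∈ I := by
  rw [MonoidHom.mem_ker, Units.ext_iff]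
  constructor
  · intro h i j
    have := congrFun (congrFun h i) j
    rw [Matrix.GeneralLinearGroup.map_apply, Units.val_one, Matrix.one_apply] at this
    rw [← Ideal.Quotient.eq, this, Matrix.one_apply]
    split_ifs <;> simp
  · intro h
    ext i j
    rw [Matrix.GeneralLinearGroup.map_apply, Units.val_one, Matrix.one_apply]
    have := Ideal.Quotient.eq.mpr (h i j)
    rw [this, Matrix.one_apply]
    split_ifs <;> simp

/-- For a principal ideal `(c)`: `x ∈ K(c) ↔ c ∣ x i j − δ i j` for all `i, j`. -/
theorem mem_ker_map_mk_span_iff (c : A) (x : GL ι A) :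
    x ∈ (Matrix.GeneralLinearGroup.map (Ideal.Quotient.mk (Ideal.span {c}))).ker ↔
      ∀ i j, c ∣ (x : Matrix ι ι A) i j - (1 : Matrix ι ι A) i j := by
  rw [mem_ker_map_mk_iff]
  simp only [Ideal.mem_span_singleton]

/-- An element of `K(c)` is `1 + c • B` for an integral matrix `B`. -/
theorem exists_eq_one_add_smul_of_mem_ker (c : A) (x : GL ι A)
    (hx : x ∈ (Matrix.GeneralLinearGroup.map (Ideal.Quotient.mk (Ideal.span {c}))).ker) :
    ∃ B : Matrix ι ι A, (x : Matrix ι ι A) = 1 + c • B := by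
  rw [mem_ker_map_mk_span_iff] at hx
  choose b hb using fun p : ι × ι => hx p.1 p.2
  refine ⟨Matrix.of fun i j => b (i, j), ?_⟩
  ext i j
  have := hb (i, j)
  rw [Matrix.add_apply, Matrix.smul_apply, Matrix.of_apply, smul_eq_mul]
  -- `this : 1 i j + ... `: `x i j - 1 i j = c * b (i, j)`
  have h2 : (x : Matrix ι ι A) i j = (1 : Matrix ι ι A) i j + c * b (i, j) := by
    rw [← this]; ring
  exact h2

/-- **The principal congruence subgroup `K(I)` has finite index** in `GL ι A` whenever `A ⧸ I`
is finite: it is the kernel of a homomorphism into the finite group `GL ι (A ⧸ I)`. -/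
theorem finiteIndex_ker_map_mk (I : Ideal A) [Finite (A ⧸ I)] :
    (Matrix.GeneralLinearGroup.map (n := ι) (Ideal.Quotient.mk I)).ker.FiniteIndex :=
  Subgroup.finiteIndex_ker _

/-- The index form: `(K(I)).index ≠ 0` when `A ⧸ I` is finite. -/
theorem index_ker_map_mk_ne_zero (I : Ideal A) [Finite (A ⧸ I)] :
    (Matrix.GeneralLinearGroup.map (n := ι) (Ideal.Quotient.mk I)).ker.index ≠ 0 :=
  (finiteIndex_ker_map_mk (ι := ι) I).index_ne_zero

end Summit.Ventures.HodgeRepro2.T5CongruenceKernel
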